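import Summits.FinalStateConjecture.FinalStateConjecture.Statement
import Literature.Geometry.Lorentzian.FutureNullCompleteness
import HarnessLib

/-!
# Future null geodesic completeness ⇒ complete future null infinity (typed clause of the crux)

Stub `stub_scriComplete_of_futureNullComplete` (W6, logic tier) of the line `birth` for the crux
`HorizonlessMustDrain` of route `BondiDrainDispersal` (item stmt-FinalStateConjecture-9976). The crux
carries the hypothesis "complete `𝓘⁺`" in the sojourn form
`Summit.FinalStateConjecture.HasCompleteNullInfinity 𝒟` (= `LorentzianMetric.HasCompleteFutureNullInfinity`
of `NullInfinity.lean` applied to the fields of the Cauchy development, under the `[HasLeviCivita]`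
binder). We prove, in ANY Cauchy development `𝒟 = (M, g, τ, ι, ν)` of data on a connected `3`-manifold,
that this hypothesis is automatic once `𝒟` is not future null geodesically incomplete: every
normalised null ray `γ` from the data hypersurface (a maximal geodesic on `dom ∋ 0` with future-directed
null velocity at `0`, `LorentzianMetric.IsNormalisedNullRayFrom`) has future-directed null velocity
throughout (`IsGeodesicOn.isNull_and_isFutureDirected_velocity`, O'Neill 1983, Ch. 3, p. 69 and Ch. 5,
Lemma 5.26), so a domain bounded above would make `(γ, dom)` a witness of
`IsFutureNullGeodesicallyIncomplete τ` (Hawking–Ellis 1973, §8.1); hence `¬ BddAbove dom` for every such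
ray (`not_bddAbove_of_isNormalisedNullRayFrom`), and complete `𝓘⁺` holds by its first disjunct
(`LorentzianMetric.hasCompleteFutureNullInfinity_of_forall_not_bddAbove`; Christodoulou, CQG 16 (1999),
p. A27; Dafermos–Rodnianski, arXiv:0811.0354, §2.6.2). This is verbatim the mechanism of route
NoParkingWithoutHorizon's support item `ScriCompleteOfComplete` (stmt-FinalStateConjecture-10030), in
`CauchyDevelopment` generality; in the skeleton it shows that L's complete-`𝓘⁺` hypothesis is idle.
Helper file for the crux (`--supports stmt-FinalStateConjecture-9976`); no definitions, no named facts.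

## References

* B. O'Neill, *Semi-Riemannian geometry with applications to relativity*, Academic Press 1983,
  Ch. 3, p. 69; Ch. 5, Lemma 5.26 (p. 141); Ch. 14, p. 435 (future null complete).
  Key `ONeillSemiRiemannian1983`.
* S. W. Hawking, G. F. R. Ellis, *The large scale structure of space-time*, CUP 1973, §8.1.
  Key `HawkingEllis1973CUP`.
* D. Christodoulou, *On the global initial value problem and the issue of singularities*, CQG 16
  (1999) A23, pp. A26–A27. Key `Christodoulou1999`.
* M. Dafermos, I. Rodnianski, *Lectures on black holes and linear waves*, arXiv:0811.0354, §2.6.2.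
  Key `arXiv08110354`.
-/

-- the stub's registered namespace repeats `FinalStateConjecture` (summit = problem name)
set_option linter.dupNamespace false

noncomputable section

open Set Filter Function
open scoped Manifold ContDiff Topology

open Literature.Geometry.Lorentzian

namespace Summit.FinalStateConjecture.FinalStateConjecture.Theorems
namespace BondiDrainDispersalHorizonlessMustDrain

namespace StubScriCompleteOfFutureNullComplete

section Development

universe u

variable {n : ℕ} {X : Type u} [TopologicalSpace X] [ChartedSpace (EuclideanSpace ℝ (Fin n)) X]
  [IsManifold (𝓡 n) ∞ X] [ConnectedSpace X] {D : InitialDataSet (𝓡 n) X}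

/-- **No future-incomplete null geodesic ⇒ every normalised null ray from the data is future
complete.** In a Cauchy development `𝒟 = (M, g, τ, ι, ν)` which is not future null geodesically
incomplete, every normalised null ray `γ` from a point `p` of the data hypersurface has affine domain
unbounded above: `γ` is a maximal geodesic of the (`C¹`, `isLocallyContMDiff_leviCivita_holds`)
Levi-Civita connection on the open interval `dom ∋ 0` with future-directed null velocity at `0`,
hence with future-directed null velocity at every parameter
(`IsGeodesicOn.isNull_and_isFutureDirected_velocity`; O'Neill 1983, Ch. 3, p. 69 and Ch. 5,
Lemma 5.26), so `BddAbove dom` would make `(γ, dom)` a future-incomplete future-directed null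
geodesic (Hawking–Ellis 1973, §8.1; O'Neill 1983, Ch. 14, p. 435, "future null complete").
[cite: ONeillSemiRiemannian1983, Ch. 14, p. 435] -/
theorem not_bddAbove_of_isNormalisedNullRayFrom (𝒟 : CauchyDevelopment D) [𝒟.metric.HasLeviCivita]
    (hc : ¬ 𝒟.metric.IsFutureNullGeodesicallyIncomplete 𝒟.timeOrientation) {p : X}
    {γ : ℝ → 𝒟.carrier} {dom : Set ℝ}
    (hγ : 𝒟.metric.IsNormalisedNullRayFrom 𝒟.timeOrientation 𝒟.embed 𝒟.normal p γ dom) :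
    ¬ BddAbove dom := by
  -- regularity bookkeeping: `C^∞` metric, hence `C¹` Levi-Civita connection
  have hn1 : (1 : ℕ∞ω) ≤ ∞ := WithTop.coe_le_coe.2 le_top
  haveI : Fact ((1 : ℕ∞ω) ≤ ∞) := ⟨hn1⟩
  have hk1 : (((1 : ℕ∞) : ℕ∞ω)) + 1 ≤ ∞ := by exact_mod_cast le_top
  haveI : CovariantDerivative.ContMDiffCovariantDerivative 𝒟.metric.leviCivita 1 :=
    ⟨𝒟.metric.isLocallyContMDiff_leviCivita_holds 1 hk1 univ isOpen_univ⟩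
  have hmax : IsMaximalGeodesicOn 𝒟.metric.leviCivita γ dom := hγ.isMaximalGeodesicOn
  intro hbdd
  exact hc ⟨γ, dom, hmax, ⟨0, hγ.zero_mem⟩, hbdd, fun t ht ↦
    IsGeodesicOn.isNull_and_isFutureDirected_velocity 𝒟.metric 𝒟.timeOrientation hmax.isOpen
      hmax.2.1 hmax.isGeodesicOn hγ.zero_mem hγ.isNull_velocity hγ.isFutureDirected_velocity ht⟩

/-- **No future-incomplete null geodesic ⇒ complete future null infinity (sojourn form).** A Cauchy
development `𝒟 = (M, g, τ, ι, ν)` which is not future null geodesically incomplete has complete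
future null infinity in Christodoulou's intrinsic sense
(`LorentzianMetric.HasCompleteFutureNullInfinity τ ι ν`), by its first disjunct: every normalised
null ray from the data hypersurface is future complete (`not_bddAbove_of_isNormalisedNullRayFrom`,
`LorentzianMetric.hasCompleteFutureNullInfinity_of_forall_not_bddAbove`, `B₀ = B₁ = ∅`).
Christodoulou, CQG 16 (1999), p. A27 (the Minkowski column); Dafermos–Rodnianski,
arXiv:0811.0354, §2.6.2. [cite: Christodoulou1999, p. A27] -/
theorem hasCompleteFutureNullInfinity_of_not_isFutureNullGeodesicallyIncomplete
    (𝒟 : CauchyDevelopment D) [𝒟.metric.HasLeviCivita]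
    (hc : ¬ 𝒟.metric.IsFutureNullGeodesicallyIncomplete 𝒟.timeOrientation) :
    𝒟.metric.HasCompleteFutureNullInfinity 𝒟.timeOrientation 𝒟.embed 𝒟.normal :=
  LorentzianMetric.hasCompleteFutureNullInfinity_of_forall_not_bddAbove fun _ _ _ hγ ↦
    not_bddAbove_of_isNormalisedNullRayFrom 𝒟 hc hγ

end Development

end StubScriCompleteOfFutureNullComplete

/-- **W6 — FUTURE NULL GEODESIC COMPLETENESS ⇒ COMPLETE FUTURE NULL INFINITY (typed clause of the
crux `HorizonlessMustDrain`).** In every Cauchy development `𝒟 = (M, g, τ, ι, ν)` of an initial data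
set on a connected `3`-manifold which is not future null geodesically incomplete (for the Levi-Civita
connection granted its existence), `Summit.FinalStateConjecture.HasCompleteNullInfinity 𝒟` holds:
under the `[HasLeviCivita]` binder of that definition, every normalised null ray from the data
hypersurface is future complete, so the sojourn form of complete `𝓘⁺` holds by its first disjunct
(`StubScriCompleteOfFutureNullComplete.hasCompleteFutureNullInfinity_of_not_isFutureNullGeodesicallyIncomplete`).
Christodoulou, CQG 16 (1999), p. A27; Dafermos–Rodnianski, arXiv:0811.0354, §2.6.2; O'Neill 1983,
Ch. 14, p. 435. [cite: Christodoulou1999, p. A27] -/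
theorem stub_scriComplete_of_futureNullComplete : open scoped Manifold in ∀ (X : Type) [TopologicalSpace X] [ChartedSpace Literature.Geometry.Lorentzian.E3 X] [IsManifold (𝓡 3) ((⊤ : ℕ∞) : WithTop ℕ∞) X] [ConnectedSpace X] (D : Literature.Geometry.Lorentzian.InitialDataSet (𝓡 3) X) (𝒟 : Literature.Geometry.Lorentzian.CauchyDevelopment D), (∀ [𝒟.metric.HasLeviCivita], ¬ 𝒟.metric.IsFutureNullGeodesicallyIncomplete 𝒟.timeOrientation) → Summit.FinalStateConjecture.HasCompleteNullInfinity 𝒟 := by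
  -- the last binder is the `[HasLeviCivita]` instance of `HasCompleteNullInfinity`; `hc` is used at it
  intro X _ _ _ _ D 𝒟 hc _
  exact StubScriCompleteOfFutureNullComplete.hasCompleteFutureNullInfinity_of_not_isFutureNullGeodesicallyIncomplete
    𝒟 hc

end BondiDrainDispersalHorizonlessMustDrain
end Summit.FinalStateConjecture.FinalStateConjecture.Theorems

end
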